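import Literature.AnabelianGeometry.EtaleTheta.DoubleUnderline
import HarnessLib

/-!
# [EtTh] §2 over §1: the model mono-theta environment data `ThetaEnvData N` of `X̲̲`, built from the
# §1 theta setting and the étale theta class (merge adapter, part 2)

Mochizuki, *The étale theta function …*, Publ. RIMS **45** (2009), §2, PRIMS PDF pp. 41, 46–47 (printed
267, 272–273) [cite: MochizukiEtTh2009, Def 2.13 p.47]. Layer L2 of the abc-iut cell, wave-2 unit
W2-L2-04, seat abc-iut-L2-t8. Continuation of `DoubleUnderline.lean`.

Given the §1 root `D : ThetaSetting` with `hC : D.Compat`, `hS : D.Sec2Hyps`, the étale theta data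
`E : D.EtaleThetaData` (seat abc-iut-L2-t1), a choice `C : E.DoubleUnderline l` of `X̲̲` and the level-`N`
cyclotome `μ : D.CyclotomeMod l N`, this file DEFINES

* `C.thetaCocycles hC μ` — "the reduction modulo `N` of any member of the collection of [cocycles
  determined by the collection of] classes `η̲̈^{Θ,l·ℤ×μ₂}` in `H¹(Π^tp_Ÿ̲̲, l·Δ_Θ)` … where we apply the
  natural isomorphism `μ_N ≅ (l·Δ_Θ) ⊗ (ℤ/Nℤ)`" (p. 46): the `l·Δ_Θ`-valued continuous cocycles on
  `Π^tp_Ÿ̲̲ = Π^tp_Ÿ ∩ Π^tp_X̲̲` whose class is a `Π^tp_X̲̲ (↠ (l·ℤ) × μ₂)`-conjugate of `η̈^Θ|_{Π^tp_Ÿ̲̲}` (p. 41: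
  "the `Π^tp_X̲̲/Π^tp_Ÿ̲̲ ≅ (l·ℤ) × μ₂`-orbit `η̲̈^{Θ,l·ℤ×μ₂}`"), composed with `(l·Δ_Θ) ↠ μ_N`;
* `C.thetaEnvData hC hS μ : ThetaEnvData N` — the interface of `MonoThetaEnv.lean` (seat abc-iut-L2-t2,
  TODO-merge(abc-iut-L2-t1)) INSTANTIATED: `Π^tp_X̲̲`, `G_K`, `Π^tp_Y̲̲ = Π^tp_Y ∩ Π^tp_X̲̲` with
  `Gal(Y̲̲/X̲̲) ≅ ℤ`, `Π^tp_Ÿ̲̲`, `μ_N`, the theta cocycles; ALL its axioms are proved here and in part 1.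

Hence t2's `ThetaEnvData.env/.sAlg/.sTheta/.DY/.modelMono/.modelBi/.IsMonoThetaEnv` (Def. 2.13) apply to
the §1 objects verbatim. HONEST FRAMING: [EtTh] is refereed; the hypothesis structures are data/named
facts quoting print, nothing else is asserted; no side is taken on any disputed claim.
-/

noncomputable section

namespace Literature.AnabelianGeometry.EtaleTheta

open Literature.AnabelianGeometry.SemiGraphs

namespace ThetaSetting

namespace EtaleThetaData.DoubleUnderline

variable {p : ℕ} [Fact p.Prime] {D : ThetaSetting p} {E : D.EtaleThetaData} {l : ℕ}
  (C : E.DoubleUnderline l) {N : ℕ+}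

/-! ### Conjugation by `1` on `H¹` -/

/-- Conjugation by the identity acts trivially on `H¹(H, A)` (bookkeeping for the orbit below).
[cite: NeukirchSchmidtWingberg2008, I §5] -/
theorem contH1_conj_one {G G' : Type*} [Group G] [TopologicalSpace G] [IsTopologicalGroup G]
    [Group G'] [TopologicalSpace G'] [IsTopologicalGroup G'] (φ : G →* G') (A : Subgroup G')
    [A.Normal] [IsMulCommutative A] {H : Subgroup G} [H.Normal] (x : ContH1 φ A H) :
    ContH1.conj φ A 1 x = x := by
  induction x using QuotientGroup.induction_on with
  | H f =>
    change (QuotientGroup.mk (ContH1.conjCocycle φ A 1 f) : ContH1 φ A H) = QuotientGroup.mk f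
    congr 1
    apply Subtype.ext
    funext y
    change MulAut.conjNormal (φ 1) (f.1 (MulAut.conjNormal (1 : G)⁻¹ y)) = f.1 y
    simp only [map_one, inv_one, MulAut.one_apply]

/-! ### `Π^tp_Ÿ̲̲` and the orbit of `η̈^Θ` -/

/-- `Π^tp_Ÿ̲̲ ⊆ Π^tp_X̲̲`, from the copy `Π^tp_Ÿ ∩ Π^tp_X̲̲ ⊆ Π^tp_X̲̲` (a subgroup of the subtype `Π^tp_X̲̲`) to the
copy `Π^tp_Ÿ ∩ Π^tp_X̲̲ ⊆ Π^tp_X`. [cite: MochizukiEtTh2009, Def 2.7 p.41] -/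
def inclYdduu : D.GtpYdd.subgroupOf C.Huu →* C.GtpYdduu where
  toFun g := ⟨((g : C.Huu) : D.PiTemp), Subgroup.mem_inf.2 ⟨g.2, (g : C.Huu).2⟩⟩
  map_one' := rfl
  map_mul' _ _ := rfl

/-- `inclYdduu` is continuous. [cite: MochizukiEtTh2009, Def 2.7 p.41] -/
theorem continuous_inclYdduu : Continuous C.inclYdduu :=
  Continuous.subtype_mk (continuous_subtype_val.comp continuous_subtype_val) _

/-- **The classes `η̲̈^{Θ,l·ℤ×μ₂}`** restricted to `Π^tp_Ÿ̲̲` (p. 41): the `Π^tp_X̲̲`-conjugates of the étale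
theta class `η̈^Θ ∈ H¹(Π^tp_Ÿ, Δ_Θ)` restricted to `Π^tp_Ÿ̲̲ = Π^tp_Ÿ ∩ Π^tp_X̲̲` ("the
`Π^tp_X̲̲/Π^tp_Ÿ̲̲ ≅ (l·ℤ) × μ₂`-orbit", p. 41; the text first lifts to `l·Δ_Θ`-coefficients — that lift is the
cocycle condition in `rootCocycles`). [cite: MochizukiEtTh2009, Def 2.7 p.41] -/
def etaOrbit (hC : D.Compat) : Set (D.H1 C.GtpYdduu) :=
  haveI := hC.GtpYdd_normal
  {x | ∃ σ ∈ C.Huu, x = ContH1.res D.toTheta D.DeltaTheta inf_le_left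
      (ContH1.conj D.toTheta D.DeltaTheta σ E.etaDd)}

/-- **The cocycles of `η̲̈^{Θ,l·ℤ×μ₂} ⊆ H¹(Π^tp_Ÿ̲̲, l·Δ_Θ)`** (p. 41, p. 46): continuous `Δ_Θ`-valued cocycles
on `Π^tp_Ÿ̲̲` WITH VALUES IN `l·Δ_Θ` whose class lies in the orbit `etaOrbit`. READING NOTE: the text's
`η̲̈^Θ ∈ H¹(Π^tp_Ÿ̲̲, l·Δ_Θ)` is an `l·Δ_Θ`-valued LIFT of `η̈^Θ|_{Π^tp_Ÿ̲̲}`, determined by the choices "up to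
multiplication by a root of unity of order `l`" (Cor. 2.8 (i), p. 42); this set collects ALL such lifts,
i.e. the union of those (at most `l`) translates — which are `O^×_K`-multiples, and "replacing
`η̲̈^{Θ,l·ℤ×μ₂}` by an `O^×_K`-multiple … corresponds to replacing `s^Θ_Ÿ̲̲` by an `O^×_K`-conjugate" (p. 47),
an operation inside `D_Y̲̲` (Def. 2.13 (i)). [cite: MochizukiEtTh2009, Def 2.13 p.46] -/
def rootCocycles (hC : D.Compat) : Set (contCocycles D.toTheta D.DeltaTheta C.GtpYdduu) :=
  {f | (∀ g, (f.1 g : D.GtpTheta) ∈ D.lDeltaTheta l) ∧ ContH1.mk f.1 f.2 ∈ C.etaOrbit hC}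

/-- **Reduction modulo `N`** of an `l·Δ_Θ`-valued cocycle "where we apply the natural isomorphism
`μ_N ≅ (l·Δ_Θ) ⊗ (ℤ/Nℤ)`" (p. 46), as a `μ_N`-valued function on `Π^tp_Ÿ̲̲ ⊆ Π^tp_X̲̲`.
[cite: MochizukiEtTh2009, Def 2.13 p.46] -/
def modN (μ : D.CyclotomeMod l N) (f : contCocycles D.toTheta D.DeltaTheta C.GtpYdduu)
    (hf : ∀ g, (f.1 g : D.GtpTheta) ∈ D.lDeltaTheta l) : D.GtpYdd.subgroupOf C.Huu → MuN p N :=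
  fun g => μ.red ⟨f.1 (C.inclYdduu g), hf _⟩

/-- **The collection of [mod `N`] theta cocycles** of `X̲̲` (p. 46): the reductions modulo `N` of the
cocycles of `η̲̈^{Θ,l·ℤ×μ₂}`. [cite: MochizukiEtTh2009, Def 2.13 p.46] -/
def thetaCocycles (hC : D.Compat) (μ : D.CyclotomeMod l N) :
    Set (D.GtpYdd.subgroupOf C.Huu → MuN p N) :=
  {η | ∃ (f : _) (hf : f ∈ C.rootCocycles hC), η = C.modN μ f hf.1}

variable (μ : D.CyclotomeMod l N)

/-- The reduction mod `N` of a cocycle is a 1-cocycle for the character `χ ∘ aug` (cocycle identity of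
`f` + `G_K`-equivariance of `(l·Δ_Θ) ↠ μ_N`). [cite: MochizukiEtTh2009, Def 2.13 p.46] -/
theorem modN_mul (f : contCocycles D.toTheta D.DeltaTheta C.GtpYdduu)
    (hf : ∀ g, (f.1 g : D.GtpTheta) ∈ D.lDeltaTheta l) (g h : D.GtpYdd.subgroupOf C.Huu) :
    C.modN μ f hf (g * h) =
      C.modN μ f hf g * galMuN p N (D.aug.toMonoidHom ((g : C.Huu) : D.PiTemp)) (C.modN μ f hf h) := by
  unfold modN
  rw [← μ.red_conj, ← map_mul]
  congr 1
  apply Subtype.ext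
  have e2 := f.2.2 (C.inclYdduu g) (C.inclYdduu h)
  change ((f.1 (C.inclYdduu (g * h)) : D.DeltaTheta) : D.GtpTheta) =
    (f.1 (C.inclYdduu g) : D.GtpTheta) *
      (D.toTheta ((g : C.Huu) : D.PiTemp) * (f.1 (C.inclYdduu h) : D.GtpTheta) *
        (D.toTheta ((g : C.Huu) : D.PiTemp))⁻¹)
  rw [map_mul, e2, Subgroup.coe_mul, MulAut.conjNormal_apply]
  rfl

/-- The reduction mod `N` of a (continuous) cocycle is continuous, i.e. locally constant (`μ_N` is
discrete). [cite: MochizukiEtTh2009, Def 2.13 p.46] -/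
theorem continuous_modN (f : contCocycles D.toTheta D.DeltaTheta C.GtpYdduu)
    (hf : ∀ g, (f.1 g : D.GtpTheta) ∈ D.lDeltaTheta l) : Continuous (C.modN μ f hf) :=
  μ.continuous_red.comp
    (Continuous.subtype_mk (continuous_subtype_val.comp (f.2.1.comp C.continuous_inclYdduu)) _)

/-- The principal crossed homomorphism `h ↦ (φ(h) a φ(h)⁻¹) · a⁻¹` of `a ∈ Δ_Θ` on a subgroup of `Π^tp_X`
is a continuous cocycle (`Π^tp_X ↠ (Π^tp_X)^Θ` is continuous).
[cite: NeukirchSchmidtWingberg2008, I §2 and II §7] -/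
theorem coboundary_mem_contCocycles (a : D.DeltaTheta) (H : Subgroup D.PiTemp) :
    (fun h : H => MulAut.conjNormal (D.toTheta (h : D.PiTemp)) a * a⁻¹) ∈
      contCocycles D.toTheta D.DeltaTheta H := by
  refine ⟨?_, fun g h => ?_⟩
  · have hc : Continuous fun h : H =>
        (MulAut.conjNormal (D.toTheta (h : D.PiTemp)) a : D.DeltaTheta) :=
      continuous_induced_rng.2 (by
        simp only [Function.comp_def, MulAut.conjNormal_apply]
        exact ((D.continuous_toTheta.comp continuous_subtype_val).mul continuous_const).mul
          (D.continuous_toTheta.comp continuous_subtype_val).inv)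
    exact hc.mul continuous_const
  · -- the cocycle identity of a principal crossed homomorphism (commutativity of `Δ_Θ`)
    have key : ∀ (t s : D.GtpTheta) (x : D.DeltaTheta),
        MulAut.conjNormal (t * s) x * x⁻¹ =
          MulAut.conjNormal t x * x⁻¹ * MulAut.conjNormal t (MulAut.conjNormal s x * x⁻¹) := by
      intro t s x
      rw [map_mul, MulAut.mul_apply, map_mul (MulAut.conjNormal t), map_inv]
      set u := MulAut.conjNormal t x
      set v := MulAut.conjNormal t (MulAut.conjNormal s x)
      rw [mul_comm' u x⁻¹, mul_comm' v u⁻¹, mul_assoc, mul_inv_cancel_left, mul_comm' x⁻¹ v]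
    dsimp only
    rw [Subgroup.coe_mul, map_mul]
    exact key _ _ _

/-- Closure of the theta cocycles under coboundaries: multiplying the reduction of `f` by the
coboundary of `c = red(a) ∈ μ_N` is the reduction of `f · ∂(a⁻¹)` ("conjugation by an element of `μ_N`
corresponds precisely to modifying a cocycle by a coboundary", p. 47).
[cite: MochizukiEtTh2009, Def 2.13 p.47] -/
theorem modN_mul_coboundary (hC : D.Compat) (f : contCocycles D.toTheta D.DeltaTheta C.GtpYdduu)
    (hf : f ∈ C.rootCocycles hC) (c : MuN p N) :
    C.modN μ f hf.1 * CycEnvelope.coboundary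
        ((((D.aug.toMonoidHom.comp C.Huu.subtype).codRestrict D.GK
          fun x => D.aug_mem_GK (x : D.PiTemp)).comp (D.GtpYdd.subgroupOf C.Huu).subtype))
        ((galMuN p N).comp D.GK.subtype) c ∈
      C.thetaCocycles hC μ := by
  obtain ⟨a, rfl⟩ := μ.red_surjective c
  -- the coboundary of `b⁻¹`, `b := a ∈ Δ_Θ`
  set b : D.DeltaTheta := ⟨(a : D.GtpTheta), D.lDeltaTheta_le l a.2⟩ with hb
  have hcob := coboundary_mem_contCocycles b⁻¹ C.GtpYdduu
  set cob : contCocycles D.toTheta D.DeltaTheta C.GtpYdduu :=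
    ⟨fun h => MulAut.conjNormal (D.toTheta (h : D.PiTemp)) b⁻¹ * b⁻¹⁻¹, hcob⟩ with hcobdef
  have hval : ∀ g, ((f * cob).1 g : D.GtpTheta) ∈ D.lDeltaTheta l := by
    intro g
    change ((f.1 g * (MulAut.conjNormal (D.toTheta (g : D.PiTemp)) b⁻¹ * b⁻¹⁻¹) : D.DeltaTheta) :
      D.GtpTheta) ∈ D.lDeltaTheta l
    rw [Subgroup.coe_mul, Subgroup.coe_mul, MulAut.conjNormal_apply, inv_inv]
    refine mul_mem (hf.1 g) (mul_mem ?_ a.2)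
    exact (D.lDeltaTheta_normal l).conj_mem _ (inv_mem a.2) _
  have hclass : ContH1.mk (f * cob).1 (f * cob).2 = ContH1.mk f.1 f.2 := by
    change (QuotientGroup.mk (f * cob) : D.H1 C.GtpYdduu) = QuotientGroup.mk f
    rw [QuotientGroup.eq, Subgroup.mem_subgroupOf, mul_inv_rev, mul_assoc, inv_mul_cancel,
      mul_one]
    exact inv_mem ((mem_contCoboundaries_iff _).2 ⟨b⁻¹, rfl⟩)
  refine ⟨f * cob, ⟨hval, hclass ▸ hf.2⟩, ?_⟩
  funext g
  have hσ := μ.red_conj ((g : C.Huu) : D.PiTemp) a⁻¹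
  rw [map_inv, map_inv] at hσ
  change μ.red ⟨(f.1 (C.inclYdduu g) : D.GtpTheta), hf.1 _⟩ *
      (μ.red a * (galMuN p N (D.aug.toMonoidHom ((g : C.Huu) : D.PiTemp)) (μ.red a))⁻¹) =
    μ.red ⟨((f * cob).1 (C.inclYdduu g) : D.GtpTheta), hval _⟩
  rw [← hσ, ← map_mul, ← map_mul]
  congr 1
  apply Subtype.ext
  change (f.1 (C.inclYdduu g) : D.GtpTheta) * ((a : D.GtpTheta) *
      (D.toTheta ((g : C.Huu) : D.PiTemp) * ((a⁻¹ : D.lDeltaTheta l) : D.GtpTheta) *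
        (D.toTheta ((g : C.Huu) : D.PiTemp))⁻¹)) =
    ((f.1 (C.inclYdduu g) * (MulAut.conjNormal (D.toTheta ((C.inclYdduu g : C.GtpYdduu) : D.PiTemp))
      b⁻¹ * b⁻¹⁻¹) : D.DeltaTheta) : D.GtpTheta)
  rw [Subgroup.coe_mul, Subgroup.coe_mul, MulAut.conjNormal_apply, inv_inv]
  congr 1
  have hcomm := D.ker_thetaToEll_comm (a : D.GtpTheta) (D.lDeltaTheta_le l a.2)
    (D.toTheta ((g : C.Huu) : D.PiTemp) * ((a⁻¹ : D.lDeltaTheta l) : D.GtpTheta) *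
      (D.toTheta ((g : C.Huu) : D.PiTemp))⁻¹)
    (D.deltaTheta_normal.conj_mem _ (D.lDeltaTheta_le l (a⁻¹).2) _)
  rw [hcomm]
  rfl

/-- The reduction of the distinguished cocycle of `DoubleUnderline.eta_res` lies in the collection:
**the theta cocycles exist** (p. 41: `η̲̈^Θ` exists). [cite: MochizukiEtTh2009, Def 2.7 p.41] -/
theorem thetaCocycles_nonempty (hC : D.Compat) : (C.thetaCocycles hC μ).Nonempty := by
  obtain ⟨f, hf, hval, hmk⟩ := C.eta_res
  haveI := hC.GtpYdd_normal
  have horb : ContH1.mk f hf ∈ C.etaOrbit hC := by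
    refine ⟨1, one_mem _, ?_⟩
    rw [contH1_conj_one]
    exact hmk
  exact ⟨C.modN μ ⟨f, hf⟩ hval, ⟨f, hf⟩, ⟨hval, horb⟩, rfl⟩

/-! ### The model data `ThetaEnvData N` of `X̲̲` -/

/-- `Π^tp_Ÿ` is open in `Π^tp_X` (under `K = K̈`, where `Π^tp_Ÿ = Π^tp_{Y₂}`).
[cite: MochizukiEtTh2009, §1 p.17] -/
theorem isOpen_GtpYdd (hS : D.Sec2Hyps) : IsOpen (D.GtpYdd : Set D.PiTemp) := by
  rw [GtpYdd_eq_GtpYN_two hS]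
  exact D.isOpen_GtpYN 2

/-- **[EtTh] Def. 2.13's "notation of the above discussion" for `X̲̲`, INSTANTIATED from §1**: the
interface `ThetaEnvData N` of `MonoThetaEnv.lean` with `Π^tp_X̲̲ := C.Huu`, `G_K`, the augmentation,
`Π^tp_Y̲̲ := Π^tp_Y ∩ Π^tp_X̲̲` with "`Gal(Y̲̲/X̲̲) (≅ l·ℤ)`" `≅ ℤ` via `toZ/l`, `Π^tp_Ÿ̲̲ := Π^tp_Ÿ ∩ Π^tp_X̲̲` of
index `2`, the cyclotome `μ_N` with its character, and the theta cocycles `thetaCocycles` — every axiom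
PROVED (this file and `DoubleUnderline.lean`). Resolves TODO-merge(abc-iut-L2-t1) of `ThetaEnvData`.
[cite: MochizukiEtTh2009, Def 2.13 p.47] -/
abbrev thetaEnvData (hC : D.Compat) (hS : D.Sec2Hyps) : ThetaEnvData.{0} N where
  PiX := C.Huu
  G := D.GK
  aug := (D.aug.toMonoidHom.comp C.Huu.subtype).codRestrict D.GK fun x => D.aug_mem_GK (x : D.PiTemp)
  aug_surjective g := by
    have hg : (g : GQp p) ∈ C.Huu.map D.aug.toMonoidHom := by rw [C.map_aug_Huu]; exact g.2
    obtain ⟨h, hh, hg'⟩ := hg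
    exact ⟨⟨h, hh⟩, Subtype.ext hg'⟩
  PiY := D.GtpY.subgroupOf C.Huu
  PiY_normal := by rw [← C.toLZ_ker]; infer_instance
  PiY_open := by
    rw [Subgroup.coe_subgroupOf]
    exact D.isOpen_ker_toZ.preimage continuous_subtype_val
  galYX :=
    haveI : (D.GtpY.subgroupOf C.Huu).Normal := by rw [← C.toLZ_ker]; infer_instance
    (QuotientGroup.quotientMulEquivOfEq C.toLZ_ker.symm).trans
      (QuotientGroup.quotientKerEquivOfSurjective C.toLZ C.toLZ_surjective)
  PiYdd := D.GtpYdd.subgroupOf C.Huu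
  PiYdd_le := Subgroup.comap_mono D.GtpYdd_le_GtpY
  PiYdd_normal := hC.GtpYdd_normal.subgroupOf C.Huu
  PiYdd_open := by
    rw [Subgroup.coe_subgroupOf]
    exact (isOpen_GtpYdd hS).preimage continuous_subtype_val
  index_PiYdd := by
    change (D.GtpYdd.subgroupOf C.Huu).relIndex (D.GtpY.subgroupOf C.Huu) = 2
    rw [← Subgroup.inf_subgroupOf_left D.GtpY C.Huu,
      Subgroup.relIndex_subgroupOf (inf_le_left : C.Huu ⊓ D.GtpY ≤ C.Huu)]
    exact C.relIndex_GtpYdd_inf hS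
  mu := MuN p N
  mu_cyclic := isCyclic_MuN p N
  card_mu := card_MuN p N
  chi := (galMuN p N).comp D.GK.subtype
  chi_ker_open := by
    have : (((((galMuN p N).comp D.GK.subtype).comp
        ((D.aug.toMonoidHom.comp C.Huu.subtype).codRestrict D.GK
          fun x => D.aug_mem_GK (x : D.PiTemp))).ker : Subgroup C.Huu) : Set C.Huu) =
        Subtype.val ⁻¹'
          ((((galMuN p N).comp D.aug.toMonoidHom).ker : Subgroup D.PiTemp) : Set D.PiTemp) := by
      ext x
      simp only [SetLike.mem_coe, MonoidHom.mem_ker, MonoidHom.coe_comp, Function.comp_apply,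
        Set.mem_preimage, Subgroup.coe_subtype]
      rfl
    rw [this]
    exact μ.isOpen_ker_chi.preimage continuous_subtype_val
  thetaCocycles := C.thetaCocycles hC μ
  thetaCocycles_nonempty := C.thetaCocycles_nonempty μ hC
  isCocycle η hη g h := by
    obtain ⟨f, hf, rfl⟩ := hη
    exact C.modN_mul μ f hf.1 g h
  locallyConstant η hη := by
    obtain ⟨f, hf, rfl⟩ := hη
    exact (IsLocallyConstant.iff_continuous _).2 (C.continuous_modN μ f hf.1)
  mul_coboundary_mem η hη c := by
    obtain ⟨f, hf, rfl⟩ := hη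
    exact C.modN_mul_coboundary μ hC f hf c

/-- The instantiated data have `Π^tp_X̲̲ = C.Huu` as underlying group (definitional bookkeeping).
[cite: MochizukiEtTh2009, Def 2.13 p.47] -/
theorem thetaEnvData_PiX (hC : D.Compat) (hS : D.Sec2Hyps) :
    (C.thetaEnvData μ hC hS).PiX = C.Huu := rfl

/-- … and theta cocycles `C.thetaCocycles hC μ`. [cite: MochizukiEtTh2009, Def 2.13 p.47] -/
theorem thetaEnvData_thetaCocycles (hC : D.Compat) (hS : D.Sec2Hyps) :
    (C.thetaEnvData μ hC hS).thetaCocycles = C.thetaCocycles hC μ := rfl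

/-! ### The theta quotient on the inverse image of `l·Δ_Θ` (used by parts 3–4) -/

/-- `Π^tp_X̲̲ ∩ (inverse image of l·Δ_Θ) → l·Δ_Θ`, the theta quotient restricted.
[cite: MochizukiEtTh2009, Prop 2.12 (i) p.45] -/
def toLDelta : (D.lDeltaTheta l).comap (D.toTheta.comp C.Huu.subtype) →* D.lDeltaTheta l :=
  ((D.toTheta.comp C.Huu.subtype).comp
    ((D.lDeltaTheta l).comap (D.toTheta.comp C.Huu.subtype)).subtype).codRestrict _ fun x => x.2

/-- `toLDelta` in coordinates. [cite: MochizukiEtTh2009, Prop 2.12 (i) p.45] -/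
@[simp] theorem coe_toLDelta (x : (D.lDeltaTheta l).comap (D.toTheta.comp C.Huu.subtype)) :
    (C.toLDelta x : D.GtpTheta) = D.toTheta ((x : C.Huu) : D.PiTemp) := rfl

end EtaleThetaData.DoubleUnderline

end ThetaSetting

end Literature.AnabelianGeometry.EtaleTheta

end
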